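import Summits.QuantumAdvantage.QuantumAdvantage.Theorems.ArithStatLadderAvgFaceBeyondPriorFactorBits
import Summits.QuantumAdvantage.QuantumAdvantage.Theorems.ArithStatLadderAvgFaceBeyondPriorCertUnitChecks
import Summits.QuantumAdvantage.QuantumAdvantage.Theorems.ArithStatLadderAvgFaceBeyondPriorCertUnitMemBQP

/-!
# QuantumAdvantage / ArithStatLadder — `AvgFaceBeyondPrior`, line `mirror-unit-signature`:
# stub `stub_oracleLangMemBQP` (stmt-QuantumAdvantage-2427) — the two oracle languages are in `BQP`

The registered stub 5bc of the lead's skeleton: GIVEN the mirror unit data (the statement of stub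
`stub_mirrorUnitData` as antecedent), (FB) the factor-bit language
`{⟨bin N, u⟩ : bit |u| of code(primeFactorsList N) = 1}` and (CU) the CERTIFIED unit language
`{⟨bin d, code(primeFactorsList d)⟩ : −d fundamental, d ≠ 3, UnitCubeAtThree d}` are in `BQP`.

Assembly of three landed files of the same namespace:

* (FB) `factorBitsLang_mem_BQP` (`…FactorBits.lean`): Shor's factoring in search form + ONE classical wrap +
  decision from search;
* (CU) `certUnitLang_mem_BQP_of_guard` (`…CertUnitMemBQP.lean`): ONE classical wrap around Hallgren's regulator
  family with Jacobson–Williams' unit residue modulo `9` in the post-processor, stated over the classical guard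
  of the language — which is `exists_goodFn` (`…CertUnitChecks.lean`: the certificate makes the promise
  decidable, the pattern of `VanDamSeroussiOracleBQP.lean`).

The antecedent (the mirror unit data) is by now itself a landed theorem (`stub_mirrorUnitData`,
`…MirrorUnitData.lean`, used inside `certUnitLang_mem_BQP_of_guard`), so it is not consumed here; the
signature is kept verbatim as registered. Everything used is proved in the tree (no Riemann hypothesis);
no definition, no named fact.
-/

set_option linter.dupNamespace false -- D-0017: single-problem summit ⇒ `QuantumAdvantage.QuantumAdvantage` by design

namespace Summit.QuantumAdvantage.QuantumAdvantage.Theorems.AvgFaceBeyondPrior.Mirror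

open _root_.Computability
open Literature.Computability.Complexity Literature.Computability.Cryptography Literature.NumberTheory.QuadraticFields

/-- **STUB 5bc of the line `mirror-unit-signature` (registered `stub_oracleLangMemBQP` of the lead's skeleton for
crux stmt-QuantumAdvantage-2427): the two oracle languages are in `BQP`, given the mirror unit data** — the
factor-bit language (`factorBitsLang_mem_BQP`) and the certified unit language (`certUnitLang_mem_BQP_of_guard`
on the guard `exists_goodFn`). [folklore] -/
theorem stub_oracleLangMemBQP :
    (∀ d : ℕ, ((((-(d:ℤ)) % 4 = 1 ∧ Squarefree (-(d:ℤ)) ∧ (-(d:ℤ)) ≠ 1) ∨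
        (4 ∣ (-(d:ℤ)) ∧ ((-(d:ℤ)) / 4 % 4 = 2 ∨ (-(d:ℤ)) / 4 % 4 = 3) ∧ Squarefree ((-(d:ℤ)) / 4)))) →
      d ≠ 3 →
      Squarefree (mirrorRadicand d) ∧ 2 ≤ mirrorRadicand d ∧
      ∃ a b : ℕ, IsMirrorFundUnit d a b ∧
        (∀ a' b' : ℕ, IsMirrorFundUnit d a' b' → a' = a ∧ b' = b) ∧
        ∀ (K : Type) [Field K] [NumberField K], Module.finrank ℚ K = 2 →
          (∃ α : K, α ^ 2 = ((mirrorRadicand d : ℕ) : K)) →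
          ∀ r : ℕ, (r = ⌊NumberField.Units.regulator K⌋₊ ∨ r = ⌈NumberField.Units.regulator K⌉₊) →
            |Real.log (((a : ℝ) + (b : ℝ) * Real.sqrt (mirrorRadicand d : ℕ)) / 2) - (r : ℝ)| < 1) →
    ({w : List Bool | ∃ (N : ℕ) (u : List Bool), w = boolPair (encodeNat N) u ∧
      (encodingListNatBool.encode (Nat.primeFactorsList N)).getD u.length false = true} ∈ BQP) ∧
    ({w : List Bool | ∃ d : ℕ, w = boolPair (encodeNat d) (encodingListNatBool.encode (Nat.primeFactorsList d)) ∧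
      ((((-(d:ℤ)) % 4 = 1 ∧ Squarefree (-(d:ℤ)) ∧ (-(d:ℤ)) ≠ 1) ∨
        (4 ∣ (-(d:ℤ)) ∧ ((-(d:ℤ)) / 4 % 4 = 2 ∨ (-(d:ℤ)) / 4 % 4 = 3) ∧ Squarefree ((-(d:ℤ)) / 4)))) ∧
      d ≠ 3 ∧ UnitCubeAtThree d} ∈ BQP) :=
  fun _ => ⟨factorBitsLang_mem_BQP, certUnitLang_mem_BQP_of_guard exists_goodFn⟩

end Summit.QuantumAdvantage.QuantumAdvantage.Theorems.AvgFaceBeyondPrior.Mirror
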